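import Summits.BirchSwinnertonDyer.BirchSwinnertonDyer.Theorems.InertBadSignedBranchesInertBadAtThreeNonNullOddHeegner
import Literature.NumberTheory.EllipticCurves.Rank1Residual.Predicates
import HarnessLib

set_option linter.dupNamespace false -- `Summit.BirchSwinnertonDyer.BirchSwinnertonDyer.Theorems.…` (summit = sub, D-0017)
set_option autoImplicit false

/-!
# Crux `HeegnerTwistCouplingInSupply` (stmt-BirchSwinnertonDyer-21381): the NULL-SET algebra of `twistDensity` and the three
# structural facts about the research stub C⁺ = `stub_nonNullIndivisibleHeegner` (monotone in the level; non-null ⇒ infinite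
# ⇒ unbounded supply; the BRR-free supply)

Route `BiquadraticEisensteinDescent` (cell `pub/bsd-wall`; width seat `bsd-wall-cm-bed-w1` g17; theorems only, `--supports 21381`).
Registered stub (line `size_tail` v4): `∀ N p, N ≠ 0 → p.Prime → 5 ≤ p → ¬ twistDensity S_{N,p} 0`, where
`S_{N,p} d := ∃ K imaginary quadratic, d_K = d ∧ 4 < |d| ∧ Heegner(N, K) ∧ p ∤ h_K` and `twistDensity P δ` is the tree's natural
density of `{d squarefree : P d}` among squarefree integers (`BSDSelmer`). The tree had the density-ONE algebra
(`twistDensity_one_mono`, `twistDensity_or_of_disjoint`) and the moment bridge (`…NonNullOfMoment`); this file supplies the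
density-ZERO / non-null algebra every consumer of C⁺ uses implicitly, and three readings of the stub:

* §1 `twistDensity_zero_mono` (sub-predicates of null predicates are null), `not_twistDensity_zero_mono` (super-predicates of
  non-null predicates are non-null), `tendsto_natCard_squarefree_abs_le_atTop` (the reference count tends to `∞`),
  `twistDensity_zero_of_finite` (a finite set is null), ★ `infinite_of_not_twistDensity_zero`, ★ `exists_lt_natAbs_of_not_twistDensity_zero`
  (a non-null predicate holds at square-free `d` of arbitrarily large `|d|`).
* §2 ★ `nonNull_of_dvd` — C⁺ is ANTITONE in the level: `M ∣ N`, C⁺(N, p) ⟹ C⁺(M, p) (Heegner for `N` ⟹ Heegner for `M`); so the stub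
  for all `N` is equivalent to the stub along any cofinal divisibility chain (e.g. `N = n!`), `nonNullIndivisibleHeegner_iff_factorial`.
* §3 ★ `exists_heegnerField_lt_natAbs_of_nonNull` — C⁺(N, p) ⟹ for every bound `B` an imaginary quadratic Heegner field `K′` of level `N`
  with `B < |d_{K′}|`, `4 < |d_{K′}|`, `p ∤ h(K′)`: the CONSEQUENT of the route's supply item `HeegnerClassNumberSupplyCMInertBadOfBRR`
  (stmt-BirchSwinnertonDyer-21380, closed from Beckwith–Raum–Richter 2022 Thm 1) follows from C⁺ ALONE — on the C⁺ road the print input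
  BRR2022 is idle (W-free, `hW`-free statement `heegnerClassNumberSupply_body_of_nonNull`).

HONEST FRAMING: nothing here proves C⁺ (open for `p ≥ 5`, Cohen–Lenstra class), the crux, or BSD. No definition, no named fact,
no `sorry`; axioms standard. [cite: arXiv250317619, §1 (densities in quadratic twist families)] [cite: GrossLMS1991, §1]
-/

noncomputable section

open scoped Classical
open Finset Filter Topology
open Literature.NumberTheory.QuadraticFields Literature.NumberTheory.EllipticCurves
open Summit.BirchSwinnertonDyer.BirchSwinnertonDyer.Theorems.InertBadSignedBranchesInertBadAtThreeNonNullOddHeegner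

namespace Summit.BirchSwinnertonDyer.BirchSwinnertonDyer.Theorems.BiquadraticEisensteinDescentHeegnerTwistCouplingInSupplyNonNullBasics

/-! ## §1 The null-set algebra of `twistDensity` -/

/-- **Monotonicity at density `0`.** If the square-free `d` with `P d` are a null set and `Q d ⟹ P d` for square-free `d`, then the
square-free `d` with `Q d` are a null set (the `Q`-proportion is squeezed between `0` and the `P`-proportion).
[cite: arXiv250317619, §1] -/
theorem twistDensity_zero_mono {P Q : ℤ → Prop} (hQP : ∀ d, Squarefree d → Q d → P d)
    (hP : twistDensity P 0) : twistDensity Q 0 := by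
  unfold twistDensity at hP ⊢
  refine tendsto_of_tendsto_of_tendsto_of_le_of_le tendsto_const_nhds hP (fun X ↦ ?_) fun X ↦ ?_
  · dsimp only
    positivity
  · have hle : Nat.card {d : ℤ | Squarefree d ∧ |d| ≤ X ∧ Q d} ≤
        Nat.card {d : ℤ | Squarefree d ∧ |d| ≤ X ∧ P d} :=
      Nat.card_mono (finite_setOf_squarefree_abs_le X P) fun d hd ↦ ⟨hd.1, hd.2.1, hQP d hd.1 hd.2.2⟩
    dsimp only
    gcongr

/-- **Non-nullity is monotone upward.** If the square-free `d` with `P d` are NOT a null set and `P d ⟹ Q d` for square-free `d`, then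
the square-free `d` with `Q d` are not a null set. [cite: arXiv250317619, §1] -/
theorem not_twistDensity_zero_mono {P Q : ℤ → Prop} (hPQ : ∀ d, Squarefree d → P d → Q d)
    (hP : ¬ twistDensity P 0) : ¬ twistDensity Q 0 :=
  fun hQ ↦ hP (twistDensity_zero_mono hPQ hQ)

/-- The reference count `#{d square-free : |d| ≤ X}` dominates the odd progression count of level `1`
(`#{−X < D < 0 : D ≡ 1 (mod 8), D square-free}`). [folklore] -/
theorem card_progression_le_natCard_squarefree_abs_le (X : ℕ) :
    ((Ico (-(X : ℤ) + 1) 0).filter (fun x => x ≡ 1 [ZMOD ((8 * 1 : ℕ) : ℤ)] ∧ Squarefree x)).card ≤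
      Nat.card {d : ℤ | Squarefree d ∧ |d| ≤ (X : ℤ)} := by
  have hsub : (↑((Ico (-(X : ℤ) + 1) 0).filter (fun x => x ≡ 1 [ZMOD ((8 * 1 : ℕ) : ℤ)] ∧ Squarefree x)) : Set ℤ) ⊆
      {d : ℤ | Squarefree d ∧ |d| ≤ (X : ℤ)} := by
    intro d hd
    rw [Finset.mem_coe, Finset.mem_filter, Finset.mem_Ico] at hd
    exact ⟨hd.2.2, abs_le.mpr ⟨by omega, by omega⟩⟩
  have h := Nat.card_mono (finite_setOf_squarefree_abs_le' X) hsub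
  rwa [Nat.card_coe_set_eq, Set.ncard_coe_finset] at h

/-- **The reference count tends to infinity**: `#{d square-free : |d| ≤ X} → ∞` (it exceeds a positive multiple of `X`, by the
tree's square-free count in the progression `1 (mod 8)`). [folklore] -/
theorem tendsto_natCard_squarefree_abs_le_atTop :
    Tendsto (fun X : ℕ ↦ (Nat.card {d : ℤ | Squarefree d ∧ |d| ≤ (X : ℤ)} : ℝ)) atTop atTop := by
  obtain ⟨c, hc0, hTc⟩ := exists_pos_tendsto_card_progression_div (N := 1) one_ne_zero
  -- eventually `T X / X > c / 2`, hence `#Sqf(X) ≥ (c/2) X`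
  have hev : ∀ᶠ X : ℕ in atTop, c / 2 * (X : ℝ) ≤ (Nat.card {d : ℤ | Squarefree d ∧ |d| ≤ (X : ℤ)} : ℝ) := by
    have h1 : ∀ᶠ X : ℕ in atTop, c / 2 < (((Ico (-(X : ℤ) + 1) 0).filter
        (fun x => x ≡ 1 [ZMOD ((8 * 1 : ℕ) : ℤ)] ∧ Squarefree x)).card : ℝ) / X :=
      (tendsto_order.1 hTc).1 _ (by linarith)
    filter_upwards [h1, eventually_gt_atTop 0] with X hX hX0
    have hX0' : (0 : ℝ) < X := by exact_mod_cast hX0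
    have h2 : c / 2 * (X : ℝ) ≤ (((Ico (-(X : ℤ) + 1) 0).filter
        (fun x => x ≡ 1 [ZMOD ((8 * 1 : ℕ) : ℤ)] ∧ Squarefree x)).card : ℝ) := by
      rw [lt_div_iff₀ hX0'] at hX
      exact hX.le
    exact h2.trans (by exact_mod_cast card_progression_le_natCard_squarefree_abs_le X)
  refine tendsto_atTop_mono' atTop hev ?_
  exact (tendsto_natCast_atTop_atTop.const_mul_atTop (by linarith : 0 < c / 2))

/-- **A finite set is null**: if only finitely many square-free `d` satisfy `P`, then `twistDensity P 0`.
[cite: arXiv250317619, §1] -/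
theorem twistDensity_zero_of_finite {P : ℤ → Prop} (hfin : {d : ℤ | Squarefree d ∧ P d}.Finite) : twistDensity P 0 := by
  unfold twistDensity
  have hbound : ∀ X : ℕ, (Nat.card {d : ℤ | Squarefree d ∧ |d| ≤ (X : ℤ) ∧ P d} : ℝ) ≤ hfin.toFinset.card := by
    intro X
    have h := Nat.card_mono hfin (fun d (hd : d ∈ {d : ℤ | Squarefree d ∧ |d| ≤ (X : ℤ) ∧ P d}) ↦ ⟨hd.1, hd.2.2⟩)
    rw [Nat.card_eq_card_finite_toFinset hfin] at h
    exact_mod_cast h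
  have hup : Tendsto (fun X : ℕ ↦ (hfin.toFinset.card : ℝ) / (Nat.card {d : ℤ | Squarefree d ∧ |d| ≤ (X : ℤ)} : ℝ))
      atTop (𝓝 0) :=
    tendsto_const_nhds.div_atTop tendsto_natCard_squarefree_abs_le_atTop
  refine tendsto_of_tendsto_of_tendsto_of_le_of_le tendsto_const_nhds hup (fun X ↦ ?_) fun X ↦ ?_
  · dsimp only
    positivity
  · dsimp only
    exact div_le_div_of_nonneg_right (hbound X) (Nat.cast_nonneg _)

/-- ★ **A non-null predicate holds infinitely often**: `¬ twistDensity P 0 ⟹ {d square-free : P d}` is infinite.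
[cite: arXiv250317619, §1] -/
theorem infinite_of_not_twistDensity_zero {P : ℤ → Prop} (hP : ¬ twistDensity P 0) :
    {d : ℤ | Squarefree d ∧ P d}.Infinite :=
  fun hfin ↦ hP (twistDensity_zero_of_finite hfin)

/-- ★ **Unbounded supply from non-nullity**: `¬ twistDensity P 0 ⟹` for every bound `B` some square-free `d` with `P d` and
`B < |d|`. [cite: arXiv250317619, §1] -/
theorem exists_lt_natAbs_of_not_twistDensity_zero {P : ℤ → Prop} (hP : ¬ twistDensity P 0) (B : ℕ) :
    ∃ d : ℤ, Squarefree d ∧ P d ∧ B < d.natAbs := by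
  by_contra h
  push Not at h
  refine infinite_of_not_twistDensity_zero hP (Set.Finite.subset (Set.finite_Icc (-(B : ℤ)) B) fun d hd ↦ ?_)
  have hle := h d hd.1 hd.2
  rw [Set.mem_Icc]
  omega

/-! ## §2 C⁺ is antitone in the level -/

/-- ★ **C⁺(N, p) ⟹ C⁺(M, p) for `M ∣ N`** (a Heegner field of level `N` is a Heegner field of level `M`, so the level-`N` counting set is
contained in the level-`M` one). [cite: GrossLMS1991, §1] -/
theorem nonNull_of_dvd {M N : ℕ} (hMN : M ∣ N) (p : ℕ)
    (hC : ¬ twistDensity (fun d : ℤ ↦ ∃ (K : Type) (_ : Field K) (_ : NumberField K),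
      IsImaginaryQuadratic K ∧ NumberField.discr K = d ∧ 4 < d.natAbs ∧
      SatisfiesHeegnerHypothesis N K ∧ ¬ p ∣ NumberField.classNumber K) 0) :
    ¬ twistDensity (fun d : ℤ ↦ ∃ (K : Type) (_ : Field K) (_ : NumberField K),
      IsImaginaryQuadratic K ∧ NumberField.discr K = d ∧ 4 < d.natAbs ∧
      SatisfiesHeegnerHypothesis M K ∧ ¬ p ∣ NumberField.classNumber K) 0 := by
  refine not_twistDensity_zero_mono (fun d _ hd ↦ ?_) hC
  obtain ⟨K, iF, iN, hK, hdK, h4, hH, hp⟩ := hd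
  exact ⟨K, iF, iN, hK, hdK, h4, hH.of_dvd hMN, hp⟩

/-- **The stub along the factorials suffices**: C⁺ for every level `N ≠ 0` (at a fixed `p`) ⟺ C⁺ for the levels `N = n!` — every
`N ≠ 0` divides `N!`. [cite: GrossLMS1991, §1] -/
theorem nonNullIndivisibleHeegner_iff_factorial (p : ℕ) :
    (∀ N : ℕ, N ≠ 0 → ¬ twistDensity (fun d : ℤ ↦ ∃ (K : Type) (_ : Field K) (_ : NumberField K),
      IsImaginaryQuadratic K ∧ NumberField.discr K = d ∧ 4 < d.natAbs ∧
      SatisfiesHeegnerHypothesis N K ∧ ¬ p ∣ NumberField.classNumber K) 0) ↔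
    (∀ n : ℕ, ¬ twistDensity (fun d : ℤ ↦ ∃ (K : Type) (_ : Field K) (_ : NumberField K),
      IsImaginaryQuadratic K ∧ NumberField.discr K = d ∧ 4 < d.natAbs ∧
      SatisfiesHeegnerHypothesis (Nat.factorial n) K ∧ ¬ p ∣ NumberField.classNumber K) 0) :=
  ⟨fun h n ↦ h _ (Nat.factorial_ne_zero n),
    fun h N hN ↦ nonNull_of_dvd (Nat.dvd_factorial (Nat.pos_of_ne_zero hN) le_rfl) p (h N)⟩

/-! ## §3 The BRR-free unbounded supply from C⁺ -/

/-- ★ **C⁺(N, p) ⟹ unbounded `p`-indivisible Heegner supply of level `N`**: for every `B` an imaginary quadratic `K′` with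
`B < |d_{K′}|`, `4 < |d_{K′}|`, the Heegner hypothesis for `N` and `p ∤ h(K′)` (a non-null set of square-free integers is unbounded).
[cite: arXiv250317619, §1] [cite: GrossLMS1991, §1] -/
theorem exists_heegnerField_lt_natAbs_of_nonNull {N p : ℕ}
    (hC : ¬ twistDensity (fun d : ℤ ↦ ∃ (K : Type) (_ : Field K) (_ : NumberField K),
      IsImaginaryQuadratic K ∧ NumberField.discr K = d ∧ 4 < d.natAbs ∧
      SatisfiesHeegnerHypothesis N K ∧ ¬ p ∣ NumberField.classNumber K) 0) (B : ℕ) :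
    ∃ (K : Type) (_ : Field K) (_ : NumberField K),
      IsImaginaryQuadratic K ∧ B < (NumberField.discr K).natAbs ∧ 4 < (NumberField.discr K).natAbs ∧
      SatisfiesHeegnerHypothesis N K ∧ ¬ p ∣ NumberField.classNumber K := by
  obtain ⟨d, -, ⟨K, iF, iN, hK, hdK, h4, hH, hp⟩, hB⟩ := exists_lt_natAbs_of_not_twistDensity_zero hC B
  exact ⟨K, iF, iN, hK, hdK ▸ hB, hdK ▸ h4, hH, hp⟩

/-- ★ **The supply item of the route, BRR-free on the C⁺ road.** The CONSEQUENT of `HeegnerClassNumberSupplyCMInertBadOfBRR`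
(stmt-BirchSwinnertonDyer-21380: «… → ∀ B, ∃ K′ imaginary quadratic, B < |d_{K′}|, 4 < |d_{K′}|, Heegner(N_W, K′), p ∤ h(K′)»,
closed in the tree from Beckwith–Raum–Richter 2022 Thm 1) follows from the registered stub C⁺ (by value) for every `(W, p)` with
`p ≥ 5` — the corner hypotheses `HasCM`, `analyticRank = 1`, `CMInert`, `¬ Good` are not used. So a route that carries C⁺ needs no
BRR input for its K′-supply. [cite: arXiv250317619, §1] [cite: GrossLMS1991, §1] -/
theorem heegnerClassNumberSupply_body_of_nonNull
    (hC : ∀ (N p : ℕ), N ≠ 0 → p.Prime → 5 ≤ p →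
      ¬ twistDensity (fun d : ℤ ↦ ∃ (K : Type) (_ : Field K) (_ : NumberField K),
        IsImaginaryQuadratic K ∧ NumberField.discr K = d ∧ 4 < d.natAbs ∧
        SatisfiesHeegnerHypothesis N K ∧ ¬ p ∣ NumberField.classNumber K) 0) :
    ∀ (W : WeierstrassCurve ℚ) [W.IsElliptic] [W.IsGloballyMinimal] (p : ℕ) [Fact p.Prime] [NeZero (W.conductorNorm ℤ)],
      W.HasCM → W.analyticRank = 1 → 5 ≤ p →
      Literature.NumberTheory.EllipticCurves.Rank1Residual.CMInert W p →
      ¬ Literature.NumberTheory.EllipticCurves.Rank1Residual.Good W p →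
      ∀ B : ℕ, ∃ (K : Type) (_ : Field K) (_ : NumberField K),
        IsImaginaryQuadratic K ∧ B < (NumberField.discr K).natAbs ∧ 4 < (NumberField.discr K).natAbs ∧
        SatisfiesHeegnerHypothesis (W.conductorNorm ℤ) K ∧ ¬ p ∣ NumberField.classNumber K := by
  intro W _ _ p hp hN _ _ hp5 _ _ B
  exact exists_heegnerField_lt_natAbs_of_nonNull (hC _ p hN.out hp.out hp5) B

end Summit.BirchSwinnertonDyer.BirchSwinnertonDyer.Theorems.BiquadraticEisensteinDescentHeegnerTwistCouplingInSupplyNonNullBasics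

end
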